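/-
Copyright (c) 2026 the pub-hodgecm-mathlib formalisation cell (harness21).  Prover seat hodgecm-mathlib-LH4-p14 (g9) (L1 valve hand; LEAD F0P6-plan (g16) BATCH #280 (2),
(dec-2-pay) F2, sub-brick F2δ), Track B «K2-LIT» ∕ hLiu418 #184♮, socket #41 KIND 1, package (K1b-♮): THE LINE'S WEYL ELEMENT AND SIEGEL UNIPOTENTS, READ IN THE
Levi-ADAPTED tube frames `T′` of ★ `K2LiuKindOneLineLeviFramesOfRecord` through Kudla's corner `blkD (1, ·)` (over ★ p865320 F2β `K2LiuKindOneLineCornerFrameReading`).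
THEOREMS ONLY (no `def`, no `instance`, no notation, no named-fact hypothesis, no `sorry`, default heartbeats).
-/
import Summits.HodgeConjecture.HodgeConjecture.Theorems.K2LiuKindOneLineCornerFrameReading   -- ★ p865320 F2β (this seat): slot algebra, index shuffle, `frame_archAt_blkD_one_adapted`
import Summits.HodgeConjecture.HodgeConjecture.Theorems.K2LiuSiegelBigCellFree                  -- ★ `blk_eq_of_mem_unipDelta` (brings ★ K2Lit `unipDelta`, `weylDelta`, `blk_weylDelta`)
import HarnessLib

/-!
# Crux `HLiu418`, socket #41, KIND 1 (K1-b♮), (dec-2-pay) F2δ — `K2LiuKindOneLineCornerFrameWeylUnip`: `w_Δ · u` OF THE LINE IN THE ADAPTED FRAME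

Cell `hodgecm-mathlib`, hLiu418 = `stmt-HodgeConjecture-24832` (helper lane, count-neutral); squad K2 ∕ K2Liu, socket #41, KIND 1.  The `hchain₁` letter of ★ p865283
`K2LiuKindOneLineBlockLetterOfRecordLam.blockLetter_rate_of_record_lam` (F1 ED. 3) bounds the rank-one Whittaker value
`∫_{N_Δ^{(B)}(𝔸)} conj ψ(u) f_s(blkD(1, w_Δ·u)·g) du` by products of archimedean line integrals `∫ Finf i σ s (ι(J₁·n₁ t)·G_σ) e(−μ_σ t) dt`.  THIS FILE is the
frame-side input: what `blkD(1, w_Δ·u)` IS at a complex place `σ` in the adapted frame `T′σ`.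
* §1 the `blk ↔ archAt` DICTIONARY for an ARBITRARY adelic element (`reindex_archAt_eq_blk_map`: `e₂⁻¹·(q_∞)_σ·e₂ = (blk q).map (a ↦ (a_∞)_σ)`; the rational case is
  ★ `K2LiuKindOneLineLeviFrameDictionary.reindex_archAt_archPart_eq_map`), the coordinate map's `0,1,+,−` on the nose (`archCoord_zero_one_add_neg`, `archCoord_sub`);
  ★ `K2LiuSiegelBigCellFree.blk_eq_of_mem_unipDelta` (`u ∈ N_Δ(𝔸)` has `blk u = [[1 − X, X],[−X, 1 + X]]`, `X = (blk u)₁₂`) gives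
  **`reindex_archAt_unip_line`** (rank one: `e₂⁻¹·(u_∞)_σ·e₂ = [[1 − x, x],[−x, 1 + x]]`, `x = ((X₀₀)_∞)_σ`), **`reindex_archAt_weylDelta`** (`e₂⁻¹·((w_Δ)_∞)_σ·e₂ = diag(1, −1)`,
  ★ `blk_weylDelta`, any rank); `reindex_mul_reindex`, `J_mul_levi`, `weylSlot_mul_unipSlot`, `slot_letters_of_ne_zero`.
* §2 HEAD **`frame_archAt_blkD_weyl_unip_adapted`** — at the frames (9)(10) of ★ p864905 BY VALUE (`eV (1,0) = 1`, `t_k(σ) ≠ 0`), for every complex `σ` and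
  `u ∈ N_Δ^{(B)}(𝔸)`: `T′σ · (e₂⁻¹·((blkD(1, w_Δ·u))_∞)_σ·e₂) · T′σ⁻¹ = ι( m(cτ′, cτ) · J₁ · n₁(2cτ′·x) )` with `c = i·sgn t₁(σ)`, `τ = |t₁(σ)|∕2`, `τ′ = τ⁻¹`,
  `x = (((blk u)₁₂ 0 0)_∞)_σ` — the Levi factor and the phase stand LEFT of `J₁·n₁` (a Siegel section turns them into a constant) and the unipotent coordinate is
  RESCALED by `2cτ′`; whence the archimedean frequency of `hchain₁` is `(|t₁|_σ∕2)·|σf|_σ` up to a universal constant (F1 ED. 3's `lam₀ ≤ · ≤ lam₁`).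
[Kudla1994, §2] [Shimura1997, §18.1 (18.4), §A3] [HarrisKudlaSweet1996, §1 (1.11)] [BorelJacquet1979, §4.1] [MoeglinWaldspurger1995, I.2.1].
HONEST LABEL.  Count-neutral helper (frame algebra + place components); closes no socket: `HC_CM` is proved only modulo the 7 printed citations (2 remaining named
inputs: hLiu418 = `stmt-HodgeConjecture-24832`, h413 = `stmt-HodgeConjecture-24833`) until rung 0 closes.

## References
* [Kudla1994] S. Kudla, Israel J. Math. 87 (1994), §2.  [Shimura1997] G. Shimura, CBMS 93 (1997), §18.1 (18.4), §A3.  [HarrisKudlaSweet1996] J. AMS 9 (1996), §1 (1.11).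
* [BorelJacquet1979] A. Borel, H. Jacquet, PSPM 33.1 (1979), §4.1.  [MoeglinWaldspurger1995] C. Mœglin, J.-L. Waldspurger, CUP (1995), I.2.1.
-/

set_option autoImplicit false
set_option linter.dupNamespace false -- the mandated namespace repeats `HodgeConjecture.HodgeConjecture`

noncomputable section

open scoped Classical
open scoped Matrix
open Complex Matrix NumberField IsDedekindDomain
open Literature.NumberTheory.Automorphic Literature.NumberTheory.GaloisRepresentations
open Literature.NumberTheory.GelbartRogawski1991 Literature.NumberTheory.GelbartRogawski1991.GRConstruction
open Literature.NumberTheory.GelbartRogawski1991.UnitaryDualPair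

namespace Summit.HodgeConjecture.HodgeConjecture.Cruxes.HLiu418.K2LiuKindOneLineCornerFrameWeylUnip

open K2LiuKindOneLineCornerFrameReading

section WeylUnip

open Literature.NumberTheory.K2Lit.SiegelDoubled

variable (L : Type) [Field L] [NumberField L] [IsCMField L]

/-- **the `blk ↔ archAt` dictionary for an arbitrary adelic element**: `e₂⁻¹·(q_∞)_σ·e₂ = (blk q).map (a ↦ (a_∞)_σ)` — the archimedean component is read
entrywise (★ `coe_archAt_apply`); the general (non-rational) twin of ★ `K2LiuKindOneLineLeviFrameDictionary.reindex_archAt_archPart_eq_map`. [cite: BorelJacquet1979, §4.1] -/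
theorem reindex_archAt_eq_blk_map {N M n : ℕ} (e : Fin N × Fin M ≃ Fin n)
    (dV : Fin N → L) (hdV : ∀ i, IsCMField.complexConj L (dV i) = dV i) (dW : Fin M → L) (hdW : ∀ i, IsCMField.complexConj L (dW i) = dW i)
    (σ : {w : InfinitePlace L // w.IsComplex}) (hw : IsCMField.complexConj L • σ.1 = σ.1) (hc : IsCMField.complexConj L ≠ 1) (q : HA L e dV hdV dW hdW) :
    Matrix.reindex (finSumFinEquiv (m := n) (n := n)).symm (finSumFinEquiv (m := n) (n := n)).symm
        (((UnitaryGroup.archAt (Fp L) L (IsCMField.complexConj L) (n + n) (hermD L e dV hdV dW hdW) σ hw hc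
            (UnitaryGroup.archPart (Fp L) L (IsCMField.complexConj L) (n + n) (hermD L e dV hdV dW hdW) q) :
            UnitaryGroup.archLocal L (n + n) (hermD L e dV hdV dW hdW) σ) : GL (Fin (n + n)) ℂ) : Matrix (Fin (n + n)) (Fin (n + n)) ℂ) =
      (blk L e dV hdV dW hdW q).map (fun a => (InfiniteAdeleRing.ringEquiv_mixedSpace L a.1).2 σ) := by
  ext i j
  simp only [Matrix.reindex_apply, Matrix.submatrix_apply, Matrix.map_apply, Equiv.symm_symm]
  rw [UnitaryGroup.coe_archAt_apply]
  rfl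

omit [IsCMField L] in
/-- the archimedean coordinate `a ↦ (a_∞)_σ : 𝔸_L → ℂ` respects `0, 1, +, −` (it is the ring homomorphism `ev_σ ∘ snd ∘ ringEquiv_mixedSpace ∘ fst`;
spelled on the nose because `AdeleRing` is a type synonym of the product). [folklore] -/
theorem archCoord_zero_one_add_neg (σ : {w : InfinitePlace L // w.IsComplex}) :
    (InfiniteAdeleRing.ringEquiv_mixedSpace L (0 : AdeleRing (𝓞 L) L).1).2 σ = 0 ∧
    (InfiniteAdeleRing.ringEquiv_mixedSpace L (1 : AdeleRing (𝓞 L) L).1).2 σ = 1 ∧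
    (∀ a b : AdeleRing (𝓞 L) L, (InfiniteAdeleRing.ringEquiv_mixedSpace L (a + b).1).2 σ =
      (InfiniteAdeleRing.ringEquiv_mixedSpace L a.1).2 σ + (InfiniteAdeleRing.ringEquiv_mixedSpace L b.1).2 σ) ∧
    (∀ a : AdeleRing (𝓞 L) L, (InfiniteAdeleRing.ringEquiv_mixedSpace L (-a).1).2 σ = -(InfiniteAdeleRing.ringEquiv_mixedSpace L a.1).2 σ) := by
  refine ⟨?_, ?_, fun a b => ?_, fun a => ?_⟩
  · rw [show (0 : AdeleRing (𝓞 L) L).1 = 0 from rfl, map_zero]; rfl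
  · rw [show (1 : AdeleRing (𝓞 L) L).1 = 1 from rfl, map_one]; rfl
  · rw [show (a + b).1 = a.1 + b.1 from rfl, map_add]; rfl
  · rw [show (-a).1 = -a.1 from rfl, map_neg]; rfl

omit [IsCMField L] in
/-- … and subtraction. [folklore] -/
theorem archCoord_sub (σ : {w : InfinitePlace L // w.IsComplex}) (a b : AdeleRing (𝓞 L) L) :
    (InfiniteAdeleRing.ringEquiv_mixedSpace L (a - b).1).2 σ =
      (InfiniteAdeleRing.ringEquiv_mixedSpace L a.1).2 σ - (InfiniteAdeleRing.ringEquiv_mixedSpace L b.1).2 σ := by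
  rw [show (a - b).1 = a.1 - b.1 from rfl, map_sub]; rfl

variable {N M n : ℕ} (e : Fin N × Fin M ≃ Fin n)
  (dV : Fin N → L) (hdV : ∀ i, IsCMField.complexConj L (dV i) = dV i) (dW : Fin M → L) (hdW : ∀ i, IsCMField.complexConj L (dW i) = dW i)

/-- **THE ARCHIMEDEAN COMPONENT OF A LINE UNIPOTENT, in block form**: on the doubled LINE (`n = 1`), for `u ∈ N_Δ(𝔸)` with corner entry `X₀₀`,
`e₂⁻¹·(u_∞)_σ·e₂ = [[1 − x, x],[−x, 1 + x]]` with `x = ((X₀₀)_∞)_σ` (`1 × 1` blocks). [cite: Kudla1994, §2] [cite: BorelJacquet1979, §4.1] -/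
theorem reindex_archAt_unip_line (eB : Fin 1 × Fin 1 ≃ Fin 1) (dB : Fin 1 → L) (hdB : ∀ i, IsCMField.complexConj L (dB i) = dB i)
    (dW : Fin 1 → L) (hdW : ∀ i, IsCMField.complexConj L (dW i) = dW i)
    (σ : {w : InfinitePlace L // w.IsComplex}) (hw : IsCMField.complexConj L • σ.1 = σ.1) (hc : IsCMField.complexConj L ≠ 1)
    {u : HA L eB dB hdB dW hdW} (hu : u ∈ unipDelta L eB dB hdB dW hdW) :
    Matrix.reindex (finSumFinEquiv (m := 1) (n := 1)).symm (finSumFinEquiv (m := 1) (n := 1)).symm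
        (((UnitaryGroup.archAt (Fp L) L (IsCMField.complexConj L) (1 + 1) (hermD L eB dB hdB dW hdW) σ hw hc
            (UnitaryGroup.archPart (Fp L) L (IsCMField.complexConj L) (1 + 1) (hermD L eB dB hdB dW hdW) u) :
            UnitaryGroup.archLocal L (1 + 1) (hermD L eB dB hdB dW hdW) σ) : GL (Fin (1 + 1)) ℂ) : Matrix (Fin (1 + 1)) (Fin (1 + 1)) ℂ) =
      fromBlocks !![1 - (InfiniteAdeleRing.ringEquiv_mixedSpace L ((blk L eB dB hdB dW hdW u).toBlocks₁₂ 0 0).1).2 σ]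
        !![(InfiniteAdeleRing.ringEquiv_mixedSpace L ((blk L eB dB hdB dW hdW u).toBlocks₁₂ 0 0).1).2 σ]
        !![-(InfiniteAdeleRing.ringEquiv_mixedSpace L ((blk L eB dB hdB dW hdW u).toBlocks₁₂ 0 0).1).2 σ]
        !![1 + (InfiniteAdeleRing.ringEquiv_mixedSpace L ((blk L eB dB hdB dW hdW u).toBlocks₁₂ 0 0).1).2 σ] := by
  obtain ⟨-, h1, hadd, hneg⟩ := archCoord_zero_one_add_neg L σ
  conv_lhs => rw [reindex_archAt_eq_blk_map L eB dB hdB dW hdW σ hw hc u, K2LiuSiegelBigCellFree.blk_eq_of_mem_unipDelta L eB dB hdB dW hdW hu, Matrix.fromBlocks_map]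
  ext i j
  rcases i with i | i <;> rcases j with j | j <;> fin_cases i <;> fin_cases j <;>
    simp only [Fin.zero_eta, Fin.isValue, Matrix.fromBlocks_apply₁₁, Matrix.fromBlocks_apply₁₂, Matrix.fromBlocks_apply₂₁,
      Matrix.fromBlocks_apply₂₂, Matrix.map_apply, Matrix.sub_apply, Matrix.add_apply, Matrix.neg_apply, Matrix.one_apply_eq,
      archCoord_sub, hadd, hneg, h1, Matrix.of_apply, Matrix.cons_val', Matrix.cons_val_fin_one, Matrix.empty_val']

/-- **THE ARCHIMEDEAN COMPONENT OF THE LINE'S WEYL ELEMENT, in block form**: `e₂⁻¹·((w_Δ)_∞)_σ·e₂ = diag(1, −1)` (★ `blk_weylDelta`; any rank).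
[cite: GelbartPiatetskishapiroRallis1987, Part A §1] [cite: BorelJacquet1979, §4.1] -/
theorem reindex_archAt_weylDelta (σ : {w : InfinitePlace L // w.IsComplex}) (hw : IsCMField.complexConj L • σ.1 = σ.1) (hc : IsCMField.complexConj L ≠ 1) :
    Matrix.reindex (finSumFinEquiv (m := n) (n := n)).symm (finSumFinEquiv (m := n) (n := n)).symm
        (((UnitaryGroup.archAt (Fp L) L (IsCMField.complexConj L) (n + n) (hermD L e dV hdV dW hdW) σ hw hc
            (UnitaryGroup.archPart (Fp L) L (IsCMField.complexConj L) (n + n) (hermD L e dV hdV dW hdW) (weylDelta L e dV hdV dW hdW)) :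
            UnitaryGroup.archLocal L (n + n) (hermD L e dV hdV dW hdW) σ) : GL (Fin (n + n)) ℂ) : Matrix (Fin (n + n)) (Fin (n + n)) ℂ) =
      fromBlocks 1 0 0 (-1) := by
  obtain ⟨h0, h1, -, hneg⟩ := archCoord_zero_one_add_neg L σ
  rw [reindex_archAt_eq_blk_map L e dV hdV dW hdW σ hw hc, blk_weylDelta, Matrix.fromBlocks_map]
  ext i j
  rcases i with i | i <;> rcases j with j | j
  · simp only [Matrix.fromBlocks_apply₁₁, Matrix.map_apply, Matrix.one_apply]
    split_ifs
    · exact h1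
    · exact h0
  · simp only [Matrix.fromBlocks_apply₁₂, Matrix.map_apply, Matrix.zero_apply, h0]
  · simp only [Matrix.fromBlocks_apply₂₁, Matrix.map_apply, Matrix.zero_apply, h0]
  · simp only [Matrix.fromBlocks_apply₂₂, Matrix.map_apply, Matrix.neg_apply, Matrix.one_apply, hneg]
    split_ifs
    · rw [h1]
    · rw [h0, neg_zero]

/-- `J₁` conjugates the Levi: `J₁ · m(a, a′) = m(a′, a) · J₁` on `Fin 1 ⊕ Fin 1`. [cite: HarrisKudlaSweet1996, §1 (1.11)] -/
theorem J_mul_levi (a a' : ℂ) :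
    Matrix.J (Fin 1) ℂ * fromBlocks !![a] 0 0 !![a'] = fromBlocks !![a'] 0 0 !![a] * Matrix.J (Fin 1) ℂ := by
  rw [Matrix.J]
  ext i j
  rcases i with i | i <;> rcases j with j | j <;> fin_cases i <;> fin_cases j <;>
    simp [Matrix.mul_apply, Fintype.sum_sum_type, fromBlocks]

/-- **the Weyl element times a unipotent in ONE adapted slot**: `(T′₁·diag(1,−1)·T′₁⁻¹)·(T′₁·[[1−x, x],[−x, 1+x]]·T′₁⁻¹) = m(cτ′, cτ)·J₁·n₁(2cτ′x)`
(§1 `slotFrame_conj_weyl` + `weylSlot_eq_smul_J_mul_levi` + `slotFrame_conj_unip` + `J_mul_levi`; `c² = −1`, `ττ′ = 1`) — Levi and phase LEFT of `J₁·n₁`.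
[cite: Shimura1997, §18.1] [cite: HarrisKudlaSweet1996, §1 (1.11)] -/
theorem weylSlot_mul_unipSlot (c τ τ' x : ℂ) :
    (fromBlocks 0 !![-(c * τ')] !![c * τ] 0 : Matrix (Fin 1 ⊕ Fin 1) (Fin 1 ⊕ Fin 1) ℂ) * fromBlocks 1 !![2 * c * τ' * x] 0 1 =
      fromBlocks !![c * τ'] 0 0 !![c * τ] * Matrix.J (Fin 1) ℂ * fromBlocks 1 !![2 * c * τ' * x] 0 1 := by
  rw [Matrix.J]
  ext i j
  rcases i with i | i <;> rcases j with j | j <;> fin_cases i <;> fin_cases j <;>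
    simp [Matrix.mul_apply, Fintype.sum_sum_type, fromBlocks, one_apply]


/-- `reindex` of a product is the product of the `reindex`es (square, one equivalence). [folklore] -/
theorem reindex_mul_reindex {k : ℕ} (A B : Matrix (Fin (k + k)) (Fin (k + k)) ℂ) :
    Matrix.reindex (finSumFinEquiv (m := k) (n := k)).symm (finSumFinEquiv (m := k) (n := k)).symm (A * B) =
      Matrix.reindex (finSumFinEquiv (m := k) (n := k)).symm (finSumFinEquiv (m := k) (n := k)).symm A *
        Matrix.reindex (finSumFinEquiv (m := k) (n := k)).symm (finSumFinEquiv (m := k) (n := k)).symm B := by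
  rw [Matrix.reindex_apply, Matrix.reindex_apply, Matrix.reindex_apply]
  exact (Matrix.submatrix_mul_equiv A B _ (finSumFinEquiv (m := k) (n := k)).symm.symm _).symm

/-- the slot letters at `t ≠ 0`: `c := i·(t∕|t|)` has `c·c = −1` and `τ := ρρ`, `τ′ := ρ′ρ′` have `τ·τ′ = 1` (`ρ = √(|t|∕2)`, `ρ′ = ρ⁻¹`, cast letters of (9)(10)).
[folklore] -/
theorem slot_letters_of_ne_zero {t : ℝ} (ht : t ≠ 0) :
    I * ((t / |t| : ℝ) : ℂ) * (I * ((t / |t| : ℝ) : ℂ)) = -1 ∧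
      (Real.sqrt (|t| / 2) : ℂ) * (Real.sqrt (|t| / 2) : ℂ) * ((((Real.sqrt (|t| / 2))⁻¹ : ℝ) : ℂ) * (((Real.sqrt (|t| / 2))⁻¹ : ℝ) : ℂ)) = 1 := by
  have h1 : Real.sqrt (|t| / 2) ≠ 0 := (Real.sqrt_pos.2 (by positivity)).ne'
  have hρ : (((Real.sqrt (|t| / 2))⁻¹ : ℝ) : ℂ) * (Real.sqrt (|t| / 2) : ℂ) = 1 := by
    rw [← ofReal_mul, inv_mul_cancel₀ h1, ofReal_one]
  have hs : ((t / |t| : ℝ) : ℂ) * ((t / |t| : ℝ) : ℂ) = 1 := by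
    rw [← ofReal_mul, ← ofReal_one, div_mul_div_comm, ← sq, ← sq, sq_abs, div_self (pow_ne_zero 2 ht)]
  exact slot_letters hρ hs

/-- **HEAD (F2δ) — THE LINE'S WEYL ELEMENT TIMES A LINE UNIPOTENT, READ IN THE ADAPTED FRAME.**  At the frames (9)(10) of ★ p864905 BY VALUE (`eV (1,0) = 1`, slot
letters `t_k(σ) ≠ 0`), for every complex `σ` and every `u ∈ N_Δ^{(B)}(𝔸)` with corner entry `X₀₀ = (blk u)₁₂ 0 0`:
`T′σ · (e₂⁻¹·((blkD(1, w_Δ·u))_∞)_σ·e₂) · T′σ⁻¹ = ι( m(cτ′, cτ) · J₁ · n₁(2cτ′·x) )`, `x = ((X₀₀)_∞)_σ`, `c = i·sgn t₁(σ)`, `τ = |t₁(σ)|∕2`, `τ′ = τ⁻¹` — the Levi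
factor and the phase sit LEFT of `J₁·n₁` (where a Siegel section turns them into a constant), and the unipotent coordinate is RESCALED by `2cτ′`: this is the
frame-side input of the `hchain₁` payer (F2) and the kernel-checked source of the per-place frequency `|μ_σ| ∝ (|t₁|_σ∕2)·|σf|_σ` (★ p865283 F1 ED. 3 `lam₀ ≤ · ≤ lam₁`).
[cite: Kudla1994, §2] [cite: Shimura1997, §18.1 (18.4), §A3] [cite: HarrisKudlaSweet1996, §1 (1.11)] [cite: BorelJacquet1979, §4.1] -/
theorem frame_archAt_blkD_weyl_unip_adapted (eV : Fin 2 × Fin 1 ≃ Fin 2) (eA eB : Fin 1 × Fin 1 ≃ Fin 1)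
    (dA : Fin 1 → L) (hdA : ∀ i, IsCMField.complexConj L (dA i) = dA i) (dB : Fin 1 → L) (hdB : ∀ i, IsCMField.complexConj L (dB i) = dB i)
    (dV : Fin 2 → L) (hdV : ∀ i, IsCMField.complexConj L (dV i) = dV i) (hVA : ∀ i, dV (Fin.castAdd 1 i) = dA i) (hVB : ∀ j, dV (Fin.natAdd 1 j) = dB j)
    (dW : Fin 1 → L) (hdW : ∀ i, IsCMField.complexConj L (dW i) = dW i)
    (ι : Matrix (Fin 1 ⊕ Fin 1) (Fin 1 ⊕ Fin 1) ℂ → Matrix (Fin 2 ⊕ Fin 2) (Fin 2 ⊕ Fin 2) ℂ)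
    (hι : ∀ x, ι x = fromBlocks !![1, 0; 0, x (Sum.inl 0) (Sum.inl 0)] !![0, 0; 0, x (Sum.inl 0) (Sum.inr 0)] !![0, 0; 0, x (Sum.inr 0) (Sum.inl 0)] !![1, 0; 0, x (Sum.inr 0) (Sum.inr 0)])
    (he : eV (1, 0) = 1) (T Tinv : {w : InfinitePlace L // w.IsComplex} → Matrix (Fin 2 ⊕ Fin 2) (Fin 2 ⊕ Fin 2) ℂ)
    (hTdef : ∀ σ, T σ = Matrix.fromBlocks (diagonal (fun k => (((Real.sqrt (|(σ.1.embedding (dV (eV.symm k).1 * dW (eV.symm k).2)).re| / 2))⁻¹ : ℝ) : ℂ))) 0 0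
          (diagonal (fun k => (Real.sqrt (|(σ.1.embedding (dV (eV.symm k).1 * dW (eV.symm k).2)).re| / 2) : ℂ))) *
        fromBlocks (diagonal (fun k => (Real.sqrt (|(σ.1.embedding (dV (eV.symm k).1 * dW (eV.symm k).2)).re| / 2) : ℂ)))
          (diagonal (fun k => (Real.sqrt (|(σ.1.embedding (dV (eV.symm k).1 * dW (eV.symm k).2)).re| / 2) : ℂ)))
          (diagonal (fun k => I * ((((σ.1.embedding (dV (eV.symm k).1 * dW (eV.symm k).2)).re / |(σ.1.embedding (dV (eV.symm k).1 * dW (eV.symm k).2)).re|) *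
            Real.sqrt (|(σ.1.embedding (dV (eV.symm k).1 * dW (eV.symm k).2)).re| / 2) : ℝ) : ℂ)))
          (-diagonal (fun k => I * ((((σ.1.embedding (dV (eV.symm k).1 * dW (eV.symm k).2)).re / |(σ.1.embedding (dV (eV.symm k).1 * dW (eV.symm k).2)).re|) *
            Real.sqrt (|(σ.1.embedding (dV (eV.symm k).1 * dW (eV.symm k).2)).re| / 2) : ℝ) : ℂ))))
    (hTinvdef : ∀ σ, Tinv σ = fromBlocks (diagonal (fun k => (((Real.sqrt (|(σ.1.embedding (dV (eV.symm k).1 * dW (eV.symm k).2)).re| / 2))⁻¹ / 2 : ℝ) : ℂ)))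
          (-diagonal (fun k => I * (((Real.sqrt (|(σ.1.embedding (dV (eV.symm k).1 * dW (eV.symm k).2)).re| / 2))⁻¹ *
            ((σ.1.embedding (dV (eV.symm k).1 * dW (eV.symm k).2)).re / |(σ.1.embedding (dV (eV.symm k).1 * dW (eV.symm k).2)).re|) / 2 : ℝ) : ℂ)))
          (diagonal (fun k => (((Real.sqrt (|(σ.1.embedding (dV (eV.symm k).1 * dW (eV.symm k).2)).re| / 2))⁻¹ / 2 : ℝ) : ℂ)))
          (diagonal (fun k => I * (((Real.sqrt (|(σ.1.embedding (dV (eV.symm k).1 * dW (eV.symm k).2)).re| / 2))⁻¹ *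
            ((σ.1.embedding (dV (eV.symm k).1 * dW (eV.symm k).2)).re / |(σ.1.embedding (dV (eV.symm k).1 * dW (eV.symm k).2)).re|) / 2 : ℝ) : ℂ))) *
        Matrix.fromBlocks (diagonal (fun k => (Real.sqrt (|(σ.1.embedding (dV (eV.symm k).1 * dW (eV.symm k).2)).re| / 2) : ℂ))) 0 0
          (diagonal (fun k => (((Real.sqrt (|(σ.1.embedding (dV (eV.symm k).1 * dW (eV.symm k).2)).re| / 2))⁻¹ : ℝ) : ℂ))))
    (σ : {w : InfinitePlace L // w.IsComplex}) (hw : IsCMField.complexConj L • σ.1 = σ.1)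
    (ht : ∀ k, (σ.1.embedding (dV (eV.symm k).1 * dW (eV.symm k).2)).re ≠ 0) {u : HA L eB dB hdB dW hdW} (hu : u ∈ unipDelta L eB dB hdB dW hdW) :
    T σ * Matrix.reindex (finSumFinEquiv (m := 2) (n := 2)).symm (finSumFinEquiv (m := 2) (n := 2)).symm
        (((UnitaryGroup.archAt (Fp L) L (IsCMField.complexConj L) (2 + 2) (hermD L eV dV hdV dW hdW) σ hw (IsCMField.complexConj_ne_one L)
            (UnitaryGroup.archPart (Fp L) L (IsCMField.complexConj L) (2 + 2) (hermD L eV dV hdV dW hdW)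
              (blkD L eV eA eB dA hdA dB hdB dV hdV hVA hVB dW hdW (1, weylDelta L eB dB hdB dW hdW * u))) :
            UnitaryGroup.archLocal L (2 + 2) (hermD L eV dV hdV dW hdW) σ) : GL (Fin (2 + 2)) ℂ) : Matrix (Fin (2 + 2)) (Fin (2 + 2)) ℂ) * Tinv σ =
      ι (fromBlocks !![I * (((σ.1.embedding (dV (eV.symm 1).1 * dW (eV.symm 1).2)).re / |(σ.1.embedding (dV (eV.symm 1).1 * dW (eV.symm 1).2)).re| : ℝ) : ℂ) *
              ((((Real.sqrt (|(σ.1.embedding (dV (eV.symm 1).1 * dW (eV.symm 1).2)).re| / 2))⁻¹ : ℝ) : ℂ) * (((Real.sqrt (|(σ.1.embedding (dV (eV.symm 1).1 * dW (eV.symm 1).2)).re| / 2))⁻¹ : ℝ) : ℂ))]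
            0 0
            !![I * (((σ.1.embedding (dV (eV.symm 1).1 * dW (eV.symm 1).2)).re / |(σ.1.embedding (dV (eV.symm 1).1 * dW (eV.symm 1).2)).re| : ℝ) : ℂ) *
              ((Real.sqrt (|(σ.1.embedding (dV (eV.symm 1).1 * dW (eV.symm 1).2)).re| / 2) : ℂ) * (Real.sqrt (|(σ.1.embedding (dV (eV.symm 1).1 * dW (eV.symm 1).2)).re| / 2) : ℂ))] *
          Matrix.J (Fin 1) ℂ *
          fromBlocks 1 !![2 * (I * (((σ.1.embedding (dV (eV.symm 1).1 * dW (eV.symm 1).2)).re / |(σ.1.embedding (dV (eV.symm 1).1 * dW (eV.symm 1).2)).re| : ℝ) : ℂ)) *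
              ((((Real.sqrt (|(σ.1.embedding (dV (eV.symm 1).1 * dW (eV.symm 1).2)).re| / 2))⁻¹ : ℝ) : ℂ) * (((Real.sqrt (|(σ.1.embedding (dV (eV.symm 1).1 * dW (eV.symm 1).2)).re| / 2))⁻¹ : ℝ) : ℂ)) *
              (InfiniteAdeleRing.ringEquiv_mixedSpace L ((blk L eB dB hdB dW hdW u).toBlocks₁₂ 0 0).1).2 σ] 0 1) := by
  obtain ⟨hc, hτ⟩ := slot_letters_of_ne_zero (ht 1)
  have hmul₁ : UnitaryGroup.archPart (Fp L) L (IsCMField.complexConj L) (1 + 1) (hermD L eB dB hdB dW hdW) (weylDelta L eB dB hdB dW hdW * u) =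
      UnitaryGroup.archPart (Fp L) L (IsCMField.complexConj L) (1 + 1) (hermD L eB dB hdB dW hdW) (weylDelta L eB dB hdB dW hdW) *
        UnitaryGroup.archPart (Fp L) L (IsCMField.complexConj L) (1 + 1) (hermD L eB dB hdB dW hdW) u := map_mul _ _ _
  have hmul₂ := map_mul (UnitaryGroup.archAt (Fp L) L (IsCMField.complexConj L) (1 + 1) (hermD L eB dB hdB dW hdW) σ hw (IsCMField.complexConj_ne_one L))
    (UnitaryGroup.archPart (Fp L) L (IsCMField.complexConj L) (1 + 1) (hermD L eB dB hdB dW hdW) (weylDelta L eB dB hdB dW hdW))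
    (UnitaryGroup.archPart (Fp L) L (IsCMField.complexConj L) (1 + 1) (hermD L eB dB hdB dW hdW) u)
  rw [frame_archAt_blkD_one_adapted L eV eA eB dA hdA dB hdB dV hdV hVA hVB dW hdW ι hι he T Tinv hTdef hTinvdef σ hw ht, hmul₁, hmul₂,
    Subgroup.coe_mul, Units.val_mul, reindex_mul_reindex, reindex_archAt_weylDelta L eB dB hdB dW hdW σ hw,
    reindex_archAt_unip_line L eB dB hdB dW hdW σ hw _ hu]
  congr 1
  rw [← weylSlot_mul_unipSlot, ← slotFrame_conj_weyl, ← slotFrame_conj_unip hc hτ]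
  simp only [Matrix.mul_assoc]
  rw [← Matrix.mul_assoc (fromBlocks !![1 / 2] _ _ _) (fromBlocks !![1] _ _ _), slotFrameInv_mul_slotFrame hc hτ, Matrix.one_mul]

end WeylUnip

end Summit.HodgeConjecture.HodgeConjecture.Cruxes.HLiu418.K2LiuKindOneLineCornerFrameWeylUnip

end
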